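import Literature.Analysis.FluidPDE.FracLaplacianCommute
import Literature.Analysis.FluidPDE.FracTransportHigher
import Literature.Analysis.FluidPDE.OnsagerBDSVBiotSavart
import HarnessLib

/-!
# The fractional Laplacian commutes with constant linear maps, with `curl` and with the
# Biot–Savart potential

De Rosa's equation for the vector potentials `z̃ᵢ = ℬ(vᵢ - v_ℓ)` (Comm. PDE 44 (2019) =
arXiv:1801.10235, §5.2, proof of Prop. 5.4: `curl(∂ₜz̃ᵢ + (v_ℓ·∇)z̃ᵢ + ν(-Δ)^γ z̃ᵢ) = …`, i.e.
`curl (-Δ)^γ z̃ᵢ = (-Δ)^γ curl z̃ᵢ = (-Δ)^γ (vᵢ - v_ℓ)` and `ℬ (-Δ)^γ = (-Δ)^γ ℬ`) uses that the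
fractional Laplacian, a Fourier multiplier acting coordinatewise, commutes with the first-order
constant-coefficient operator `curl` and with `ℬ = -Δ⁻¹ curl`. This file proves it for the accepted
`Torus.fracLaplacian` (smooth fields, `θ ≥ 0`):

* `Torus.oneSubLapIter_clm_comp`, `Torus.fracLaplacian_clm_comp` — `(-Δ)^θ (L ∘ a) = L ∘ (-Δ)^θ a`
  for a constant linear `L : ℝ^d → ℝ^d` (mollification representation
  `Torus.fracLaplacian_eq_convolution`);
* `BDSV.fracLaplacian_coordTransfer` — consequently `(-Δ)^θ` acts coordinatewise on `𝕋³`;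
* `BDSV.curl_fracLaplacian_comm` — **`curl (-Δ)^θ Z = (-Δ)^θ curl Z`**;
* `BDSV.biotSavart_fracLaplacian_comm` — **`ℬ (-Δ)^θ w = (-Δ)^θ ℬ w`**;
* `BDSV.divergence_fracLaplacian_biotSavart` — `div (-Δ)^θ ℬ w = 0`.

## References

* L. De Rosa, Comm. PDE 44 (2019) = arXiv:1801.10235, §5.2 proof of Prop. 5.4. [`Derosa2018`]
* L. Grafakos, *Classical Fourier Analysis*, 3rd ed. (2014), Prop. 3.1.2 (9) (Fourier multipliers
  commute with constant-coefficient operators).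
-/

noncomputable section

open MeasureTheory Set Filter Function
open scoped ContDiff Convolution

namespace Literature.Analysis.FluidPDE

/-! ## `(-Δ)^θ` commutes with constant linear maps of the values -/

namespace Torus

open FunctionSpaces FunctionSpaces.Torus

variable {d : Type} [Fintype d] [DecidableEq d]

/-- `(1 - (4π²)⁻¹Δ)^m (L ∘ a) = L ∘ (1 - (4π²)⁻¹Δ)^m a` for smooth `a` and a constant continuous
linear `L`. [folklore] -/
theorem oneSubLapIter_clm_comp {a : UnitAddTorus d → EuclideanSpace ℝ d} (ha : IsSmooth a)
    (L : EuclideanSpace ℝ d →L[ℝ] EuclideanSpace ℝ d) (m : ℕ) :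
    oneSubLapIter m (fun x => L (a x)) = fun x => L (oneSubLapIter m a x) := by
  induction m with
  | zero => rfl
  | succ m ih =>
    have hsm : IsSmooth (oneSubLapIter m a) := isSmooth_iterate_oneSubLaplacian ha m
    have eL : oneSubLapIter (m + 1) (fun x => L (a x)) = fun x => oneSubLapIter m (fun x => L (a x)) x -
        (4 * Real.pi ^ 2)⁻¹ • Torus.laplacian (oneSubLapIter m (fun x => L (a x))) x := by
      rw [oneSubLapIter_def, oneSubLapIter_def, iterate_succ_apply']
    have eR : oneSubLapIter (m + 1) a = fun x => oneSubLapIter m a x -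
        (4 * Real.pi ^ 2)⁻¹ • Torus.laplacian (oneSubLapIter m a) x := by
      rw [oneSubLapIter_def, oneSubLapIter_def, iterate_succ_apply']
    rw [eL, eR, ih]
    funext x
    have h1 : Torus.laplacian (fun y => L (oneSubLapIter m a y)) x = L (Torus.laplacian (oneSubLapIter m a) x) :=
      laplacian_clm_comp_apply hsm L x
    simp only
    rw [h1, map_sub, map_smul]

/-- **`(-Δ)^θ (L ∘ a) = L ∘ (-Δ)^θ a`** for smooth `a`, `θ ≥ 0` and a constant continuous linear
`L : ℝ^d → ℝ^d` (`(-Δ)^θ a = K_θ ⋆ (1 - (4π²)⁻¹Δ)^M a`; mollification and `Δ` commute with `L`).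
[folklore] -/
theorem fracLaplacian_clm_comp {θ : ℝ} (hθ : 0 ≤ θ) {a : UnitAddTorus d → EuclideanSpace ℝ d}
    (ha : IsSmooth a) (L : EuclideanSpace ℝ d →L[ℝ] EuclideanSpace ℝ d) :
    fracLaplacian θ (fun x => L (a x)) = fun x => L (fracLaplacian θ a x) := by
  have hLa : IsSmooth (fun x => L (a x)) := ha.comp_clm L
  have hg : IsSmooth (oneSubLapIter (fracKerOrder θ d) a) := isSmooth_iterate_oneSubLaplacian ha _
  rw [fracLaplacian_eq_convolution hθ hLa, oneSubLapIter_clm_comp ha L, fracLaplacian_eq_convolution hθ ha]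
  funext x
  exact convolution_clm_comp_apply (integrable_fracKernel hθ) hg.continuous L x

end Torus

/-! ## `(-Δ)^θ` commutes with `curl` and `ℬ` on `𝕋³` -/

namespace BDSV

open FunctionSpaces FunctionSpaces.Torus

variable {Z w : UnitAddTorus (Fin 3) → EuclideanSpace ℝ (Fin 3)} {θ : ℝ}

/-- **`(-Δ)^θ` acts coordinatewise**: for the constant map `E_{ab} y = y_b e_a`,
`((-Δ)^θ (E_{ab} ∘ G))_a = ((-Δ)^θ G)_b` (`θ ≥ 0`, smooth `G`). [folklore] -/
theorem fracLaplacian_coordTransfer (hθ : 0 ≤ θ) {G : UnitAddTorus (Fin 3) → EuclideanSpace ℝ (Fin 3)}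
    (hG : IsSmooth G) (a b : Fin 3) (x : UnitAddTorus (Fin 3)) :
    Torus.fracLaplacian θ (fun y => ((EuclideanSpace.proj b : EuclideanSpace ℝ (Fin 3) →L[ℝ] ℝ).smulRight
      (EuclideanSpace.single a (1 : ℝ))) (G y)) x a = Torus.fracLaplacian θ G x b := by
  rw [Torus.fracLaplacian_clm_comp hθ hG]
  simp

/-- **`curl (-Δ)^θ Z = (-Δ)^θ curl Z`** for smooth `Z` on `𝕋³` and `θ ≥ 0` (De Rosa, proof of
Prop. 5.4: the dissipative term of the equation for `z̃ᵢ`). [cite: Derosa2018, §5.2 proof of Prop. 5.4] -/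
theorem curl_fracLaplacian_comm (hθ : 0 ≤ θ) (hZ : IsSmooth Z) (x : UnitAddTorus (Fin 3)) :
    curl (Torus.fracLaplacian θ Z) x = Torus.fracLaplacian θ (curl Z) x := by
  -- the coordinate maps
  set E : Fin 3 → Fin 3 → (EuclideanSpace ℝ (Fin 3) →L[ℝ] EuclideanSpace ℝ (Fin 3)) := fun a b =>
    (EuclideanSpace.proj b : EuclideanSpace ℝ (Fin 3) →L[ℝ] ℝ).smulRight (EuclideanSpace.single a (1 : ℝ)) with hE
  have hE_apply : ∀ a b (y : EuclideanSpace ℝ (Fin 3)) (i : Fin 3), E a b y i = if i = a then y b else 0 := by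
    intro a b y i
    simp [hE]
  have hD : ∀ j, IsSmooth (FunctionSpaces.Torus.partialDeriv j Z) := fun j => hZ.partialDeriv j
  have hc : IsSmooth (curl Z) := isSmooth_curl hZ
  have hEs : ∀ a b {G : UnitAddTorus (Fin 3) → EuclideanSpace ℝ (Fin 3)}, IsSmooth G → IsSmooth (fun y => E a b (G y)) :=
    fun a b G hG => hG.comp_clm (E a b)
  -- the left-hand side in coordinates: `∂ⱼ(-Δ)^θZ = (-Δ)^θ∂ⱼZ`
  have hL : ∀ j, FunctionSpaces.Torus.partialDeriv j (Torus.fracLaplacian θ Z) = Torus.fracLaplacian θ (FunctionSpaces.Torus.partialDeriv j Z) := fun j =>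
    Torus.partialDeriv_fracLaplacian_comm hθ hZ j
  -- the right-hand side in coordinates
  have key : ∀ (a j k c e : Fin 3), (∀ y, curl Z y a = FunctionSpaces.Torus.partialDeriv j Z y c - FunctionSpaces.Torus.partialDeriv k Z y e) →
      Torus.fracLaplacian θ (curl Z) x a =
        Torus.fracLaplacian θ (FunctionSpaces.Torus.partialDeriv j Z) x c - Torus.fracLaplacian θ (FunctionSpaces.Torus.partialDeriv k Z) x e := by
    intro a j k c e hform
    -- `E_{aa} ∘ curl Z = E_{ac} ∘ ∂ⱼZ - E_{ae} ∘ ∂ₖZ`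
    have hfun : (fun y => E a a (curl Z y)) = fun y => E a c (FunctionSpaces.Torus.partialDeriv j Z y) - E a e (FunctionSpaces.Torus.partialDeriv k Z y) := by
      funext y
      ext i
      rw [PiLp.sub_apply, hE_apply, hE_apply, hE_apply]
      split_ifs with hi
      · exact hform y
      · simp
    rw [← fracLaplacian_coordTransfer hθ hc a a x, show (fun y => ((EuclideanSpace.proj a : EuclideanSpace ℝ (Fin 3) →L[ℝ] ℝ).smulRight
      (EuclideanSpace.single a (1 : ℝ))) (curl Z y)) = fun y => E a a (curl Z y) from rfl, hfun,
      Torus.fracLaplacian_sub hθ (hEs a c (hD j)) (hEs a e (hD k))]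
    simp only [PiLp.sub_apply]
    rw [show (fun y => E a c (FunctionSpaces.Torus.partialDeriv j Z y)) = fun y => ((EuclideanSpace.proj c : EuclideanSpace ℝ (Fin 3) →L[ℝ] ℝ).smulRight
      (EuclideanSpace.single a (1 : ℝ))) (FunctionSpaces.Torus.partialDeriv j Z y) from rfl, fracLaplacian_coordTransfer hθ (hD j) a c x,
      show (fun y => E a e (FunctionSpaces.Torus.partialDeriv k Z y)) = fun y => ((EuclideanSpace.proj e : EuclideanSpace ℝ (Fin 3) →L[ℝ] ℝ).smulRight
      (EuclideanSpace.single a (1 : ℝ))) (FunctionSpaces.Torus.partialDeriv k Z y) from rfl, fracLaplacian_coordTransfer hθ (hD k) a e x]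
  ext a
  fin_cases a
  · simp only [Fin.zero_eta]
    rw [curl_apply_zero, hL 1, hL 2, key 0 1 2 2 1 fun y => curl_apply_zero Z y]
  · simp only [Fin.mk_one]
    rw [curl_apply_one, hL 2, hL 0, key 1 2 0 0 2 fun y => curl_apply_one Z y]
  · simp only [Fin.reduceFinMk]
    rw [curl_apply_two, hL 0, hL 1, key 2 0 1 1 0 fun y => curl_apply_two Z y]

/-- **`ℬ (-Δ)^θ w = (-Δ)^θ ℬ w`** for smooth `w` on `𝕋³` and `θ ≥ 0` (`ℬ = -Δ⁻¹ curl`; `(-Δ)^θ`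
commutes with `Δ⁻¹`, `Torus.fracLaplacian_invLaplacian_comm`, and with `curl`). [cite: Derosa2018, §5.2 proof of Prop. 5.4] -/
theorem biotSavart_fracLaplacian_comm (hθ : 0 ≤ θ) (hw : IsSmooth w) :
    biotSavart (Torus.fracLaplacian θ w) = Torus.fracLaplacian θ (biotSavart w) := by
  have hc : IsSmooth (curl w) := isSmooth_curl hw
  have hΛ : IsSmooth (Torus.fracLaplacian θ w) := hw.fracLaplacian hθ
  have hI : IsSmooth (invLaplacian (curl w)) := isSmooth_invLaplacian hc
  have hcurl : curl (Torus.fracLaplacian θ w) = Torus.fracLaplacian θ (curl w) :=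
    funext (curl_fracLaplacian_comm hθ hw)
  have hB : biotSavart w = (-1 : ℝ) • invLaplacian (curl w) := by
    rw [biotSavart_eq]; funext x; simp
  rw [biotSavart_eq, hcurl, ← Torus.fracLaplacian_invLaplacian_comm hθ hc, hB, Torus.fracLaplacian_const_smul]
  funext x
  simp

/-- **`div (-Δ)^θ ℬ w = 0`** for smooth `w` and `θ ≥ 0`. [folklore] -/
theorem divergence_fracLaplacian_biotSavart (hθ : 0 ≤ θ) (hw : IsSmooth w) (x : UnitAddTorus (Fin 3)) :
    divergence (Torus.fracLaplacian θ (biotSavart w)) x = 0 := by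
  rw [← biotSavart_fracLaplacian_comm hθ hw]
  exact divergence_biotSavart (hw.fracLaplacian hθ) x

end BDSV

end Literature.Analysis.FluidPDE
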